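import Summits.BirchSwinnertonDyer.Rank1Residual.Additive.LocalTowerKernelCardEqTamagawaCyclotomic
import Summits.BirchSwinnertonDyer.Rank1Residual.Additive.LocalTowerKernelDescent
import Summits.BirchSwinnertonDyer.Rank1Residual.GaloisImage.TorsionCocycleDescent
import Literature.NumberTheory.EllipticCurves.SubgroupSelmerProofs
import HarnessLib

/-!
# HT-C3 — Greenberg's local Tamagawa kernel at `ℓ ∤ p` on the FULL Galois group:
# `#ker(H¹(K_v, E) → H¹((K_∞)_w, E)) = p ^ ord_p c_v(E)` (hand h5 of the CDC road of crux
# `SupersingularRankZeroAtTwo`, stmt-BirchSwinnertonDyer-19097, line `odd_blind_package`, slot 5)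

HONEST FRAMING (cell `bsd-2adic`, seat `bsd-2adic-tower-1` GEN 60): TOOL THEOREMS ONLY — no definition,
no named fact, no instance, no `sorry`; `--supports stmt-BirchSwinnertonDyer-19097 --as helper`; closes no
stub and no item (19097 stays OPEN, CDC / CDC_H is NOT claimed); nothing booked (D-0054); BSD is proved
for no curve; typed ≠ proved.

## What

The LEAD (ss-1 GEN 21, `HOME/ss/gen21/HAND-TARGETS-CDC-2.md` §2 h5, scratch
`HANDTARGETS_CDC2_GEN21.lean` :45) asks for the order of the kernel of the restriction
`res : H¹(Γ_{K_v}, E(K̄_v)) → H¹(H_{v,∞}, E(K̄_v))` along the tree's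
`subgroupIncl (localSubgroup κ.kerSubgroup K_v)` (`H_{v,∞} = Gal(K̄_v / K_v·K_∞)`), i.e. of
`H¹(Gal((K_∞)_w/K_v), E((K_∞)_w))` by inflation–restriction, for `W/ℚ`, `κ` cyclotomic, `ℓ ∤ p`:
`= p ^ ord_p c_ℓ(E)` (Greenberg, LNM 1716, §3 Lemma 3.3 and p. 88: "`|ker(r_v)| = c_v^{(p)}`").

The tree already proves Greenberg's count in the currency of the LEVEL-`0` LOCAL TOWER KERNEL
`𝒦_{v,0} = ker(H¹(H_{v,0}, E(K̄_v)) → H¹(H_{v,∞}, E(K̄_v)))` (`WeierstrassCurve.localTowerKer κ K_v 0`,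
`H_{v,0} = localSubgroup (κ.layerSubgroup 0) K_v`, the preimage of `κ⁻¹(p⁰ℤ_p) = ⊤`) and of its
`p`-power torsion `𝒦_{v,0}[p^∞]` (`localTowerKerPrimary`):
`Rank1Residual.Additive.natCard_localTowerKerPrimary_zero_eq_pow_of_isCyclotomic` (cell b2b-bsdres, x1b
GEN 35, files 50–54: inflation cocycles via the local `ℤ_p`-extension, `M_∞/B` uniquely `p`-divisible,
X11b's `[B_v : (γ_v − 1)B_v] = p ^ ord_p c_v`; hypothesis-free for the cyclotomic tower, where no finite
place splits completely). This file supplies the two bookkeeping steps between that currency and the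
hand's:

* §1 `resOfLe_comp_resH1Hom_layer_zero`, `mem_ker_resH1Hom_iff_mem_localTowerKer`: restriction to
  `H_{v,∞}` (resp. `H_{v,n}`) on `H¹(Γ_{K_v}, ·)` is restriction to `H_{v,0}` followed by the tree's
  `resOfLe` (functoriality `resH1Hom_comp`), so the hand's kernel is the preimage of `𝒦_{v,0}` under
  `res₀ : H¹(Γ_{K_v}) → H¹(H_{v,0})`, which is BIJECTIVE (`bijective_resH1Hom_subgroupIncl`, every
  element of `Γ_{K_v}` lies in `H_{v,0}`).
* §2 `exists_pow_smul_eq_zero_of_mem_ker_resH1Hom` — **the hand's kernel is `p`-primary** (any field `K`,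
  any `ℤ_p`-extension, any `K`-field `E`, any Weierstrass curve): a class dying on `H_{E,∞} = ⋂ₙ H_{E,n}`
  dies on some `H_{E,n}` (the tree's descent `exists_forall_resOfLe_localSubgroup_eq_zero_of_mem_localTowerKer_zero`,
  compactness of `Γ_E`), is then represented by a cocycle vanishing on the open subgroup `H_{E,n}`
  (`ResKernel.exists_cocycle_of_res_eq_zero`), hence is killed by `[Γ_E : H_{E,n}]` (elementary
  corestriction `GaloisImage.Descent.exists_index_nsmul_eq_smul_sub`), a divisor of
  `[Γ_K : κ⁻¹(pⁿℤ_p)] = pⁿ` (`ZpExtension.index_layerSubgroup`, `Subgroup.index_comap`,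
  `Subgroup.relIndex_dvd_index_of_normal`). Hence `𝒦_{E,0} = 𝒦_{E,0}[p^∞]`
  (`localTowerKer_zero_eq_localTowerKerPrimary`) and
  `natCard_ker_resH1Hom_eq_natCard_localTowerKerPrimary`: `#ker(res) = #𝒦_{E,0}[p^∞]`.
* §3 the counts: `natCard_ker_resH1Hom_eq_pow_padicValNat_localTamagawaNumber_of_not_split` (any number
  field, any `ℤ_p`-extension, `v ∤ p` not split completely), `…_of_isCyclotomic` (cyclotomic, any `v ∤ p`),
  and **`HTC3_natCard_ker_resTower_eq_pow_padicValNat_localTamagawaNumber`** — the hand, TYPE VERBATIM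
  from the LEAD's scratch (`[W.IsGloballyMinimal]` is idle for the count and kept as typed).

References: [GreenbergLNM1716] R. Greenberg, *Iwasawa theory for elliptic curves*, LNM 1716 (1999), §3
Lemma 3.3 (pp. 86–88, "`|ker(r_v)| = c_v^{(p)}`"), §4 proof of Prop. 4.1; [SerreGaloisCohomology1997]
J.-P. Serre, *Galois Cohomology*, I.§2.4 (res, cor), I.§2.6 (inflation–restriction);
[MilneADT2006] J. S. Milne, *Arithmetic Duality Theorems*, I Prop. 3.8.
-/

set_option autoImplicit false
set_option linter.dupNamespace false

noncomputable section

open scoped Classical NumberField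

universe u

namespace Summit.BirchSwinnertonDyer.BirchSwinnertonDyer.Theorems.FlatBlindTamagawaKernel

open NumberField IsDedekindDomain Field WeierstrassCurve Literature.NumberTheory.EllipticCurves
  Literature.NumberTheory.GaloisRepresentations ZpExtension
open Summit.BirchSwinnertonDyer.Rank1Residual

/-! ## §1 The hand's kernel and the level-`0` local tower kernel -/

section Functoriality

variable {G : Type u} [Group G] [TopologicalSpace G] [IsTopologicalGroup G]
  (M : Type u) [AddCommGroup M] [DistribMulAction G M] [TopologicalSpace M] [DiscreteTopology M]

/-- **Functoriality of restriction** (generic): for subgroups `H ≤ H'` of a topological group `G` and a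
discrete `G`-module `M`, restriction `H¹(G, M) → H¹(H, M)` is restriction to `H'` followed by the tree's
`resOfLe` along `H ≤ H'` (`resH1Hom_comp`). [cite: SerreGaloisCohomology1997, I.§2.4] -/
theorem resOfLe_comp_resH1Hom_subgroupIncl {H H' : Subgroup G} (h : H ≤ H') :
    (Literature.NumberTheory.EllipticCurves.resOfLe M h).comp
      (resH1Hom (Literature.NumberTheory.EllipticCurves.subgroupIncl H') (AddMonoidHom.id M)
        (fun _ _ ↦ rfl)) =
      resH1Hom (Literature.NumberTheory.EllipticCurves.subgroupIncl H) (AddMonoidHom.id M)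
        (fun _ _ ↦ rfl) := by
  unfold Literature.NumberTheory.EllipticCurves.resOfLe
  rw [resH1Hom_comp]
  exact resH1Hom_congr (ContinuousMonoidHom.ext fun _ ↦ rfl) (AddMonoidHom.ext fun _ ↦ rfl) _ _

end Functoriality

section Generic

variable {K : Type u} [Field K] (W : WeierstrassCurve K) {p : ℕ} [hp : Fact p.Prime]
  (κ : ZpExtension K p) (E : Type u) [Field E] [Algebra K E]

/-- Every element of `Γ_E` lies in `H_{E,0} = (Γ_E → Γ_K)⁻¹(κ⁻¹(p⁰ℤ_p))`. [folklore] -/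
theorem mem_localSubgroup_layerSubgroup_zero (σ : Field.absoluteGaloisGroup E) :
    σ ∈ localSubgroup (κ.layerSubgroup 0) E := by
  rw [mem_localSubgroup_iff, ZpExtension.layerSubgroup_zero]
  exact Subgroup.mem_top _

/-- **Functoriality**: restriction `H¹(Γ_E, E(K̄_E)) → H¹(H_{E,n}, E(K̄_E))` is restriction to `H_{E,0}`
followed by the tree's `resOfLe` along `H_{E,n} ≤ H_{E,0}` (`resH1Hom_comp`).
[cite: SerreGaloisCohomology1997, I.§2.4] -/
theorem resOfLe_comp_resH1Hom_layer_zero (n : ℕ) :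
    (Literature.NumberTheory.EllipticCurves.resOfLe (localPoints W E)
        (Subgroup.comap_mono (κ.layerSubgroup_antitone (Nat.zero_le n)) :
          localSubgroup (κ.layerSubgroup n) E ≤ localSubgroup (κ.layerSubgroup 0) E)).comp
      (resH1Hom (Literature.NumberTheory.EllipticCurves.subgroupIncl (localSubgroup (κ.layerSubgroup 0) E))
        (AddMonoidHom.id (localPoints W E)) (fun _ _ ↦ rfl)) =
      resH1Hom (Literature.NumberTheory.EllipticCurves.subgroupIncl (localSubgroup (κ.layerSubgroup n) E))
        (AddMonoidHom.id (localPoints W E)) (fun _ _ ↦ rfl) :=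
  resOfLe_comp_resH1Hom_subgroupIncl (localPoints W E) _

/-- **Functoriality at `∞`**: restriction `H¹(Γ_E, E(K̄_E)) → H¹(H_{E,∞}, E(K̄_E))` is restriction to
`H_{E,0}` followed by the tree's `resOfLe` along `H_{E,∞} ≤ H_{E,0}` (the map whose kernel is
`localTowerKer κ E 0`). [cite: SerreGaloisCohomology1997, I.§2.4] -/
theorem resOfLe_ker_comp_resH1Hom_layer_zero :
    (Literature.NumberTheory.EllipticCurves.resOfLe (localPoints W E)
        (WeierstrassCurve.localSubgroup_ker_le_layer κ E 0)).comp
      (resH1Hom (Literature.NumberTheory.EllipticCurves.subgroupIncl (localSubgroup (κ.layerSubgroup 0) E))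
        (AddMonoidHom.id (localPoints W E)) (fun _ _ ↦ rfl)) =
      resH1Hom (Literature.NumberTheory.EllipticCurves.subgroupIncl (localSubgroup κ.kerSubgroup E))
        (AddMonoidHom.id (localPoints W E)) (fun _ _ ↦ rfl) :=
  resOfLe_comp_resH1Hom_subgroupIncl (localPoints W E) _

/-- **The hand's kernel is the preimage of `𝒦_{E,0}` under `res₀ : H¹(Γ_E) → H¹(H_{E,0})`**: a class of
`H¹(Γ_E, E(K̄_E))` dies on `H_{E,∞}` iff its restriction to `H_{E,0}` lies in the level-`0` local tower
kernel `WeierstrassCurve.localTowerKer κ E 0`. [cite: GreenbergLNM1716, §3 p. 86] -/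
theorem mem_ker_resH1Hom_iff_mem_localTowerKer
    (x : discreteH1 (Field.absoluteGaloisGroup E) (localPoints W E)) :
    x ∈ (resH1Hom (Literature.NumberTheory.EllipticCurves.subgroupIncl (localSubgroup κ.kerSubgroup E))
        (AddMonoidHom.id (localPoints W E)) (fun _ _ ↦ rfl)).ker ↔
      resH1Hom (Literature.NumberTheory.EllipticCurves.subgroupIncl (localSubgroup (κ.layerSubgroup 0) E))
        (AddMonoidHom.id (localPoints W E)) (fun _ _ ↦ rfl) x ∈ W.localTowerKer κ E 0 := by
  rw [AddMonoidHom.mem_ker, W.mem_localTowerKer_iff κ E 0, ← AddMonoidHom.comp_apply,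
    resOfLe_ker_comp_resH1Hom_layer_zero]

/-- `[Γ_E : H_{E,n}]` is a power of `p`: `H_{E,n}` is the preimage of the normal subgroup
`κ⁻¹(pⁿℤ_p) ≤ Γ_K` of index `pⁿ` (`ZpExtension.index_layerSubgroup`), so its index divides `pⁿ`
(`Subgroup.index_comap`, `Subgroup.relIndex_dvd_index_of_normal`). [cite: Washington1997, §13.1] -/
theorem exists_index_localSubgroup_layerSubgroup_eq_pow (n : ℕ) :
    ∃ m ≤ n, (localSubgroup (κ.layerSubgroup n) E).index = p ^ m := by
  rw [← Nat.dvd_prime_pow hp.out, localSubgroup_eq_comap, Subgroup.index_comap,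
    ← κ.index_layerSubgroup n]
  exact Subgroup.relIndex_dvd_index_of_normal _ _

end Generic

/-! ## §2 The hand's kernel is `p`-primary -/

section Primary

variable {K : Type u} [Field K] (W : WeierstrassCurve K) {p : ℕ} [hp : Fact p.Prime]
  (κ : ZpExtension K p) (E : Type u) [Field E] [Algebra K E]

/-- **The kernel of `res : H¹(Γ_E, E(K̄_E)) → H¹(H_{E,∞}, E(K̄_E))` is `p`-primary** (any field `K`,
any `ℤ_p`-extension `κ`, any `K`-field `E`, any Weierstrass curve): a class `x` dying on
`H_{E,∞} = ⋂ₙ H_{E,n}` dies on some `H_{E,n}` (compactness of `Γ_E`; the tree's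
`exists_forall_resOfLe_localSubgroup_eq_zero_of_mem_localTowerKer_zero`), so it is represented by a
continuous cocycle vanishing on the open subgroup `H_{E,n}` (`ResKernel.exists_cocycle_of_res_eq_zero`)
and `[Γ_E : H_{E,n}] • x = 0` by the elementary corestriction
(`GaloisImage.Descent.exists_index_nsmul_eq_smul_sub`: `[G:N] • φ(g) = g • b − b`); the index is a power
of `p` (`exists_index_localSubgroup_layerSubgroup_eq_pow`). Equivalently: `Gal(E·K_∞/E) ↪ ℤ_p` is
pro-`p`, so `H¹` of it is `p`-primary. [cite: SerreGaloisCohomology1997, I.§2.4 and I.§2.6]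
[cite: GreenbergLNM1716, §3 p. 86] -/
theorem exists_pow_smul_eq_zero_of_mem_ker_resH1Hom
    (x : discreteH1 (Field.absoluteGaloisGroup E) (localPoints W E))
    (hx : x ∈ (resH1Hom (Literature.NumberTheory.EllipticCurves.subgroupIncl (localSubgroup κ.kerSubgroup E))
        (AddMonoidHom.id (localPoints W E)) (fun _ _ ↦ rfl)).ker) :
    ∃ k : ℕ, p ^ k • x = 0 := by
  -- the class dies at a finite layer `H_{E,n}`
  have hx0 := (mem_ker_resH1Hom_iff_mem_localTowerKer W κ E x).mp hx
  obtain ⟨n, hn⟩ :=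
    Additive.exists_forall_resOfLe_localSubgroup_eq_zero_of_mem_localTowerKer_zero W κ E hx0
  have hres : ResKernel.resSubgroup (localSubgroup (κ.layerSubgroup n) E) (localPoints W E) x = 0 := by
    have h : ((Literature.NumberTheory.EllipticCurves.resOfLe (localPoints W E)
        (Subgroup.comap_mono (κ.layerSubgroup_antitone (Nat.zero_le n)) :
          localSubgroup (κ.layerSubgroup n) E ≤ localSubgroup (κ.layerSubgroup 0) E)).comp
      (resH1Hom (Literature.NumberTheory.EllipticCurves.subgroupIncl
        (localSubgroup (κ.layerSubgroup 0) E)) (AddMonoidHom.id (localPoints W E)) (fun _ _ ↦ rfl))) x =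
        0 := hn n le_rfl
    rw [resOfLe_comp_resH1Hom_layer_zero] at h
    exact h
  -- a cocycle representative vanishing on `H_{E,n}`
  obtain ⟨φ, hφx, hφN⟩ := ResKernel.exists_cocycle_of_res_eq_zero (localSubgroup (κ.layerSubgroup n) E)
    (localPoints W E) (continuous_smul_localPoints W E) x hres
  -- elementary corestriction: `[Γ_E : H_{E,n}] • φ` is principal
  haveI : CompactSpace (Field.absoluteGaloisGroup E) := absoluteGaloisGroup_compactSpace E
  haveI : Finite (Field.absoluteGaloisGroup E ⧸ localSubgroup (κ.layerSubgroup n) E) :=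
    Subgroup.quotient_finite_of_isOpen _ (isOpen_localSubgroup_layerSubgroup E κ n)
  obtain ⟨b, hb⟩ := GaloisImage.Descent.exists_index_nsmul_eq_smul_sub
    (localSubgroup (κ.layerSubgroup n) E) φ.1 (fun g h ↦ φ.2 g h) hφN
  obtain ⟨m, -, hm⟩ := exists_index_localSubgroup_layerSubgroup_eq_pow κ E n
  refine ⟨m, ?_⟩
  rw [← hφx, ← oneCocycleClassₗ_apply, ← map_nsmul, oneCocycleClassₗ_apply, oneCocycleClass_eq_zero_iff]
  refine ⟨b, fun g ↦ ?_⟩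
  have e : ((p ^ m • φ : contOneCocycles (discreteTopRep (Field.absoluteGaloisGroup E)
      (localPoints W E))) : C(Field.absoluteGaloisGroup E, localPoints W E)) g = p ^ m • φ.1 g := by
    rw [AddSubmonoidClass.coe_nsmul, ContinuousMap.coe_nsmul, Pi.smul_apply]
  rw [e, ← hm]
  exact hb g

/-- **`𝒦_{E,0} = 𝒦_{E,0}[p^∞]`**: the level-`0` local tower kernel is `p`-primary (transport of
`exists_pow_smul_eq_zero_of_mem_ker_resH1Hom` along the bijective `res₀ : H¹(Γ_E) → H¹(H_{E,0})`,
`bijective_resH1Hom_subgroupIncl`). [cite: GreenbergLNM1716, §3 p. 86] -/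
theorem localTowerKer_zero_eq_localTowerKerPrimary :
    W.localTowerKer κ E 0 = W.localTowerKerPrimary κ E 0 := by
  refine le_antisymm (fun y hy ↦ ?_) (WeierstrassCurve.localTowerKerPrimary_le_localTowerKer W κ E 0)
  rw [W.mem_localTowerKerPrimary_iff κ E 0]
  refine ⟨hy, ?_⟩
  obtain ⟨x, rfl⟩ := (bijective_resH1Hom_subgroupIncl (localPoints W E)
    (localSubgroup (κ.layerSubgroup 0) E) (mem_localSubgroup_layerSubgroup_zero κ E)).2 y
  obtain ⟨k, hk⟩ := exists_pow_smul_eq_zero_of_mem_ker_resH1Hom W κ E x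
    ((mem_ker_resH1Hom_iff_mem_localTowerKer W κ E x).mpr hy)
  exact ⟨k, by rw [← map_nsmul, hk, map_zero]⟩

/-- **`#ker(res : H¹(Γ_E, E(K̄_E)) → H¹(H_{E,∞}, E(K̄_E))) = #𝒦_{E,0}[p^∞]`**: `res₀` restricts to a
bijection from the hand's kernel onto `localTowerKerPrimary κ E 0` (§1, §2).
[cite: GreenbergLNM1716, §3 Lemma 3.3 (p. 86)] -/
theorem natCard_ker_resH1Hom_eq_natCard_localTowerKerPrimary :
    Nat.card (resH1Hom (Literature.NumberTheory.EllipticCurves.subgroupIncl (localSubgroup κ.kerSubgroup E))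
        (AddMonoidHom.id (localPoints W E)) (fun _ _ ↦ rfl)).ker =
      Nat.card (W.localTowerKerPrimary κ E 0) := by
  have hbij := bijective_resH1Hom_subgroupIncl (localPoints W E)
    (localSubgroup (κ.layerSubgroup 0) E) (mem_localSubgroup_layerSubgroup_zero κ E)
  have hmem : ∀ x : (resH1Hom (Literature.NumberTheory.EllipticCurves.subgroupIncl (localSubgroup κ.kerSubgroup E))
      (AddMonoidHom.id (localPoints W E)) (fun _ _ ↦ rfl)).ker,
      resH1Hom (Literature.NumberTheory.EllipticCurves.subgroupIncl (localSubgroup (κ.layerSubgroup 0) E))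
        (AddMonoidHom.id (localPoints W E)) (fun _ _ ↦ rfl) (x : discreteH1 _ _) ∈
        W.localTowerKerPrimary κ E 0 := fun x ↦ by
    rw [← localTowerKer_zero_eq_localTowerKerPrimary]
    exact (mem_ker_resH1Hom_iff_mem_localTowerKer W κ E _).mp x.2
  refine Nat.card_congr (Equiv.ofBijective (fun x ↦ ⟨_, hmem x⟩) ⟨fun a b hab ↦ ?_, fun y ↦ ?_⟩)
  · exact Subtype.ext (hbij.1 (Subtype.ext_iff.mp hab))
  · obtain ⟨x, hx⟩ := hbij.2 (y : discreteH1 _ _)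
    have hy : (y : discreteH1 _ _) ∈ W.localTowerKer κ E 0 :=
      WeierstrassCurve.localTowerKerPrimary_le_localTowerKer W κ E 0 y.2
    refine ⟨⟨x, (mem_ker_resH1Hom_iff_mem_localTowerKer W κ E x).mpr (hx ▸ hy)⟩, Subtype.ext hx⟩

end Primary

/-! ## §3 The counts -/

section Count

variable {K : Type u} [Field K] [NumberField K] (W : WeierstrassCurve K) {p : ℕ} [Fact p.Prime]
  (κ : ZpExtension K p)

/-- **`#ker(H¹(K_v, E) → H¹((K_∞)_w, E)) = p ^ ord_p c_v` at every `v ∤ p` that does NOT split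
completely in `K_∞/K`** (`E = W` elliptic over a number field `K`, any `ℤ_p`-extension `κ`, any reduction
type; the kernel on the FULL Galois group `Γ_{K_v}`): §2 with cell b2b-bsdres' count
`Rank1Residual.Additive.natCard_localTowerKerPrimary_zero_eq_pow_padicValNat_localTamagawaNumber`.
Greenberg, LNM 1716, §3 p. 88: "`|ker(r_v)| = c_v^{(p)}`".
[cite: GreenbergLNM1716, §3 Lemma 3.3 (pp. 86–88)] -/
theorem natCard_ker_resH1Hom_eq_pow_padicValNat_localTamagawaNumber_of_not_split [W.IsElliptic]
    {v : HeightOneSpectrum (𝓞 K)} (hpv : (p : 𝓞 K) ∉ v.asIdeal)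
    (hns : ∃ δ : Field.absoluteGaloisGroup (v.adicCompletion K),
      resGal (K := K) (v.adicCompletion K) δ ∉ κ.kerSubgroup) :
    Nat.card (resH1Hom (Literature.NumberTheory.EllipticCurves.subgroupIncl (localSubgroup κ.kerSubgroup (v.adicCompletion K)))
        (AddMonoidHom.id (localPoints W (v.adicCompletion K))) (fun _ _ ↦ rfl)).ker =
      p ^ padicValNat p ((W.baseChange (v.adicCompletion K)).localTamagawaNumber
        (v.adicCompletionIntegers K)) := by
  rw [natCard_ker_resH1Hom_eq_natCard_localTowerKerPrimary]
  exact Additive.natCard_localTowerKerPrimary_zero_eq_pow_padicValNat_localTamagawaNumber W κ hpv hns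

end Count

section Cyclotomic

/-- **`#ker(H¹(K_v, E) → H¹((K_∞)_w, E)) = p ^ ord_p c_v` at EVERY `v ∤ p` for the cyclotomic
`ℤ_p`-extension** (no finite place splits completely there; cell b2b-bsdres'
`natCard_localTowerKerPrimary_zero_eq_pow_of_isCyclotomic`). [cite: GreenbergLNM1716, §3 Lemma 3.3 (pp. 86–88)]
[cite: Washington1997, §13.1] -/
theorem natCard_ker_resH1Hom_eq_pow_padicValNat_localTamagawaNumber_of_isCyclotomic
    {K : Type} [Field K] [NumberField K] (W : WeierstrassCurve K) [W.IsElliptic] {p : ℕ} [Fact p.Prime]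
    {κ : ZpExtension K p} (hκ : κ.IsCyclotomic) {v : HeightOneSpectrum (𝓞 K)}
    (hpv : (p : 𝓞 K) ∉ v.asIdeal) :
    Nat.card (resH1Hom (Literature.NumberTheory.EllipticCurves.subgroupIncl (localSubgroup κ.kerSubgroup (v.adicCompletion K)))
        (AddMonoidHom.id (localPoints W (v.adicCompletion K))) (fun _ _ ↦ rfl)).ker =
      p ^ padicValNat p ((W.baseChange (v.adicCompletion K)).localTamagawaNumber
        (v.adicCompletionIntegers K)) := by
  rw [natCard_ker_resH1Hom_eq_natCard_localTowerKerPrimary]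
  exact Additive.natCard_localTowerKerPrimary_zero_eq_pow_of_isCyclotomic W hκ hpv

/-- **HT-C3 = h5 (GREENBERG'S LOCAL TAMAGAWA KERNEL at a place `ℓ ∤ p`), the LEAD's hand VERBATIM.**
For an elliptic curve `W/ℚ` (globally minimal model; idle for the count), a prime `p`, the cyclotomic
`ℤ_p`-extension `κ` and a finite place `ℓ` with `ℓ ∤ p`: the kernel of the restriction
`H¹(ℚ_ℓ, E) → H¹((ℚ_∞)_w, E)` (`resH1Hom` along `localSubgroup κ.kerSubgroup ℚ_ℓ ≤ Γ_{ℚ_ℓ}`, i.e.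
`H¹(Gal((ℚ_∞)_w/ℚ_ℓ), E((ℚ_∞)_w))` by inflation–restriction, `(ℚ_∞)_w` = THE unramified
`ℤ_p`-extension of `ℚ_ℓ`) is finite of order EXACTLY `p^{v_p(c_ℓ(E))}`, `c_ℓ = [E(ℚ_ℓ) : E₀(ℚ_ℓ)]` the
tree's `localTamagawaNumber` (so it is trivial at good `ℓ`). Greenberg's local factor at `v ∤ p`
(Lemma 3.3 / proof of Prop. 4.1; Mazur's local norm index at an unramified `v ∤ p`). CDC road:
`#𝓚'_ℓ = c_ℓ(W₂)^{(2)}` (step 4, Tamagawa splitting), consumed at `W := W₂`, `p := 2`, every odd bad `ℓ`.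
[cite: GreenbergLNM1716, §3 Lemma 3.3 and §4 proof of Prop. 4.1 (local factor at v ∤ p)]
[cite: Mazur1972Towers, §4 (local norm index at v ∤ p unramified)]
[cite: MilneADT2006, I Cor. 3.4 and Rem. 3.6 (Tate local duality for E, H¹ of an unramified extension)] -/
theorem HTC3_natCard_ker_resTower_eq_pow_padicValNat_localTamagawaNumber
    (W : WeierstrassCurve ℚ) [W.IsElliptic] [W.IsGloballyMinimal] (p : ℕ) [Fact p.Prime]
    {κ : ZpExtension ℚ p} (hκ : κ.IsCyclotomic)
    (ℓ : HeightOneSpectrum (𝓞 ℚ)) (hℓ : ((p : ℕ) : 𝓞 ℚ) ∉ ℓ.asIdeal) :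
    Nat.card (resH1Hom (Literature.NumberTheory.EllipticCurves.subgroupIncl
          (localSubgroup κ.kerSubgroup (ℓ.adicCompletion ℚ)))
        (AddMonoidHom.id (localPoints W (ℓ.adicCompletion ℚ))) (fun _ _ ↦ rfl)).ker =
      p ^ padicValNat p ((W.baseChange (ℓ.adicCompletion ℚ)).localTamagawaNumber (ℓ.adicCompletionIntegers ℚ)) :=
  natCard_ker_resH1Hom_eq_pow_padicValNat_localTamagawaNumber_of_isCyclotomic W hκ hℓ

end Cyclotomic

end Summit.BirchSwinnertonDyer.BirchSwinnertonDyer.Theorems.FlatBlindTamagawaKernel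

end
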